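import Summits.CriticalPhenomena.CardyFormulaZ2.Theorems.CardyFlipRussoCoveringLegStubCoveringBridgeDict
import Literature.Probability.Percolation.SiteConnectionTools
import Literature.Probability.Percolation.PlanarDuality
import Literature.Probability.Percolation.CardyFormula
import HarnessLib

/-!
# The event sandwich of Kesten's covering (stub `stub_coveringBridge`, line `five-arm-null`, crux `CoveringLeg`)

Helper file `--supports stmt-CriticalPhenomena-6435` (stub `stub_coveringBridge` = `CardySectorGap.CoveringBridge`,
stmt-CriticalPhenomena-7055).  Under the covering map `coverMap` (type-I site `inl x` open iff the `ℤ²`-edge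
`coverEdge x` is open; type II closed, type III open) an open site path of `G_s` is "morally" an open bond
path of `ℤ²` and conversely (Beffara 2008 §5.1, Kesten 1982 §3.4), but the crude crossing EVENTS of a domain
`Ω` at mesh `δ` are not literally equal: the site event constrains the edge MIDPOINTS (type-I sites) to lie
in `Ω` and carries the `2δ`-slack at a midpoint, the bond event constrains the VERTICES.  What does hold
exactly, for every `Ω, A, B ⊆ ℂ` and `δ > 0`, is the two-sided sandwich proved here:

* `cover_bondCross_subset_preimage` — a crude bond crossing whose vertices keep distance `δ` from `Ωᶜ`
  (window `{w | closedBall w δ ⊆ Ω}`, same arcs, same slack) is, read through `coverMap`, a crude site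
  crossing of `Ω` (for lattice configurations `η ⊆ E(ℤ²)`, an almost sure event);
* `cover_preimage_siteCross_subset` — a crude site crossing of `Ω`, read back, is a crude bond crossing
  with window the `δ`-thickening of `Ω` and slack `3δ`;

plus the slack transfer to `δ`-thickened arcs (`cover_infDist_thickening_le`).  The resulting PROBABILITY
sandwich (via the exact coupling `cover_map_bondPercolation` of `…StubCoveringBridgeCoupling.lean`) and the
reduction of the stub to ONE boundary-insensitivity statement are in `…StubCoveringBridge.lean`.  All
discrepancies live within distance `δ` of `∂Ω`.
-/

noncomputable section

namespace Summit.CriticalPhenomena.CardyFormulaZ2.Cruxes.CoveringLeg.FiveArmNull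

open MeasureTheory Measure ProbabilityTheory unitInterval
open Literature.Probability.LatticeModels
open Literature.Probability.Percolation
open Literature.Barriers.CriticalPhenomena (MixedSite mixedParam)


/-! ### Metric bookkeeping -/

/-- The endpoints of the edge of a type-I site drawn in the window `Ω` lie in the `δ`-thickening of `Ω`
(they are at distance `δ√2/2 < δ` from the midpoint). [cite: Beffara2008Universal, §5.1] -/
theorem cover_mem_thickening_of_dist {δ : ℝ} (hδ : 0 < δ) {Ω : Set ℂ} {p m : ℂ}
    (hm : (δ : ℂ) * m ∈ Ω) (hd : dist p m = Real.sqrt 2 / 2) :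
    (δ : ℂ) * p ∈ Metric.thickening δ Ω := by
  rw [Metric.mem_thickening_iff]
  refine ⟨(δ : ℂ) * m, hm, ?_⟩
  rw [dist_eq_norm, ← mul_sub, norm_mul, Complex.norm_real, Real.norm_of_nonneg hδ.le,
    ← dist_eq_norm, hd]
  calc δ * (Real.sqrt 2 / 2) < δ * 1 := mul_lt_mul_of_pos_left cover_sqrt_two_div_two_lt_one hδ
    _ = δ := mul_one δ

/-- … and within `3δ` of any set within `2δ` of the midpoint. [cite: Beffara2008Universal, §5.1] -/
theorem cover_infDist_le_three {δ : ℝ} (hδ : 0 < δ) {A : Set ℂ} {p m : ℂ}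
    (hm : Metric.infDist ((δ : ℂ) * m) A ≤ 2 * δ) (hd : dist p m = Real.sqrt 2 / 2) :
    Metric.infDist ((δ : ℂ) * p) A ≤ 3 * δ := by
  have h1 := Metric.infDist_le_infDist_add_dist (s := A) (x := (δ : ℂ) * p) (y := (δ : ℂ) * m)
  rw [dist_eq_norm, ← mul_sub, norm_mul, Complex.norm_real, Real.norm_of_nonneg hδ.le,
    ← dist_eq_norm, hd] at h1
  have h2 : δ * (Real.sqrt 2 / 2) ≤ δ * 1 :=
    mul_le_mul_of_nonneg_left cover_sqrt_two_div_two_lt_one.le hδ.le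
  linarith

/-- A point at distance `δ√2/2 ≤ δ` from the centre of a closed `δ`-ball inside `Ω` lies in `Ω`.
[cite: Beffara2008Universal, §5.1] -/
theorem cover_mem_of_closedBall_subset {δ : ℝ} (hδ : 0 < δ) {Ω : Set ℂ} {p c : ℂ}
    (hc : Metric.closedBall ((δ : ℂ) * c) δ ⊆ Ω) (hd : dist p c = Real.sqrt 2 / 2) :
    (δ : ℂ) * p ∈ Ω := by
  refine hc (Metric.mem_closedBall.2 ?_)
  rw [dist_eq_norm, ← mul_sub, norm_mul, Complex.norm_real, Real.norm_of_nonneg hδ.le,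
    ← dist_eq_norm, hd]
  calc δ * (Real.sqrt 2 / 2) ≤ δ * 1 :=
      mul_le_mul_of_nonneg_left cover_sqrt_two_div_two_lt_one.le hδ.le
    _ = δ := mul_one δ

/-- Slack transfer to thickened arcs: a point within `3δ` of `A` is within `2δ` of the `δ`-thickening of `A`
(in a normed space `infEDist x (thickening δ A) = infEDist x A - δ`, Mathlib's `infEDist_thickening`; trivial
for `A = ∅`). [folklore] -/
theorem cover_infDist_thickening_le {δ : ℝ} (hδ : 0 < δ) {A : Set ℂ} {p : ℂ}
    (h : Metric.infDist p A ≤ 3 * δ) : Metric.infDist p (Metric.thickening δ A) ≤ 2 * δ := by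
  rcases A.eq_empty_or_nonempty with rfl | hA
  · simp only [Metric.thickening_empty, Metric.infDist_empty]
    positivity
  · have hne : Metric.infEDist p A ≠ ⊤ := Metric.infEDist_ne_top hA
    rw [Metric.infDist, infEDist_thickening hδ]
    refine ENNReal.toReal_le_of_le_ofReal (by positivity) ?_
    rw [tsub_le_iff_right, ← ENNReal.ofReal_add (by positivity) hδ.le,
      ← ENNReal.ofReal_toReal hne]
    refine ENNReal.ofReal_le_ofReal ?_
    have : (Metric.infEDist p A).toReal = Metric.infDist p A := rfl
    rw [this]
    linarith

/-- Open crossing events are monotone in the window and in the two target sets. [folklore] -/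
theorem cover_openCrossing_mono {V : Type*} {S S' A A' B B' : Set V} (hS : S ⊆ S') (hA : A ⊆ A')
    (hB : B ⊆ B') : (openCrossing S A B : Set (BondConfig V)) ⊆ openCrossing S' A' B' := by
  rintro ω ⟨x, hx, y, hy, hxS, hyS, hr⟩
  exact ⟨x, hA hx, y, hB hy, hS hxS, hS hyS,
    hr.map (SimpleGraph.induceHomOfLE (G := openGraph ω) hS).toHom⟩

/-! ### Local bond connections along one covering edge -/

/-- If the edge of `x` is open and both its endpoints lie in the window `S`, then its first endpoint is
joined inside `S` to any vertex of that edge. [cite: Kesten1982, §3.4] -/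
theorem cover_openConnIn_coverFst {η : Set (Sym2 (Site 2))} {S : Set (Site 2)} {x : ℤ × ℤ}
    (hx : coverEdge x ∈ η) (h1 : coverFst x ∈ S) (h2 : coverSnd x ∈ S) {w : Site 2}
    (hw : w ∈ coverEdge x) : η ∈ openConnIn S (coverFst x) w := by
  rcases Sym2.mem_iff.1 hw with rfl | rfl
  · exact ⟨h1, h1, SimpleGraph.Reachable.refl _⟩
  · refine ⟨h1, h2, SimpleGraph.Adj.reachable ?_⟩
    simp only [SimpleGraph.comap_adj, Function.Embedding.coe_subtype, openGraph_adj]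
    exact ⟨hx, coverFst_ne_coverSnd x⟩

/-! ### Direction A: a site crossing of `Ω` is a bond crossing of the thickened window -/

/-- The representative `ℤ²`-vertex of a covering site: first endpoint of its edge for a type-I site, the
carried vertex for a face centre. [cite: Kesten1982, §3.4] -/
theorem cover_rep_mem_window {δ : ℝ} (hδ : 0 < δ) {Ω : Set ℂ} {η : Set (Sym2 (Site 2))}
    {a : MixedSite} (ho : a ∈ coverMap η) (hW : (δ : ℂ) * coverZ a ∈ Ω) :
    (δ : ℂ) * squareLatticeEmbedding.z (Sum.elim coverFst coverVertex a) ∈ Metric.thickening δ Ω := by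
  cases a with
  | inl x => exact cover_mem_thickening_of_dist hδ hW (cover_dist_coverFst x)
  | inr f =>
    rw [cover_inr_mem_coverMap_iff] at ho
    rw [Sum.elim_inr, ← cover_z_inr_eq ho]
    exact Metric.self_subset_thickening hδ Ω hW

/-- **One step of direction A.** Two `G_s`-adjacent covering-open sites drawn in `Ω` have representatives
joined by an open bond path inside the thickened window: adjacent type-I sites are two open edges at a
common vertex (`cover_exists_odd_corner`), a type-I site adjacent to an (open, hence odd) face centre is an
open edge at that vertex (`coverVertex_mem_coverEdge`). [cite: Beffara2008Universal, §5.1] -/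
theorem cover_step_site_to_bond {δ : ℝ} (hδ : 0 < δ) {Ω : Set ℂ} {η : Set (Sym2 (Site 2))}
    {a b : MixedSite} (hab : centredSquareGraph.Adj a b) (hao : a ∈ coverMap η) (hbo : b ∈ coverMap η)
    (haW : (δ : ℂ) * coverZ a ∈ Ω) (hbW : (δ : ℂ) * coverZ b ∈ Ω) :
    η ∈ openConnIn {y : Site 2 | (δ : ℂ) * squareLatticeEmbedding.z y ∈ Metric.thickening δ Ω}
      (Sum.elim coverFst coverVertex a) (Sum.elim coverFst coverVertex b) := by
  have win : ∀ x : ℤ × ℤ, (δ : ℂ) * coverZ (Sum.inl x) ∈ Ω →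
      coverFst x ∈ {y : Site 2 | (δ : ℂ) * squareLatticeEmbedding.z y ∈ Metric.thickening δ Ω} ∧
      coverSnd x ∈ {y : Site 2 | (δ : ℂ) * squareLatticeEmbedding.z y ∈ Metric.thickening δ Ω} :=
    fun x hx => ⟨cover_mem_thickening_of_dist hδ hx (cover_dist_coverFst x),
      cover_mem_thickening_of_dist hδ hx (cover_dist_coverSnd x)⟩
  cases a with
  | inl x =>
    cases b with
    | inl y =>
      obtain ⟨f, hf, hxf, hyf⟩ := cover_exists_odd_corner hab
      have h1 := cover_openConnIn_coverFst hao (win x haW).1 (win x haW).2 (coverVertex_mem_coverEdge hxf hf)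
      have h2 := cover_openConnIn_coverFst hbo (win y hbW).1 (win y hbW).2 (coverVertex_mem_coverEdge hyf hf)
      exact PlanarDuality.openConnIn_trans h1 ((openConnIn_comm _ _ _) ▸ h2)
    | inr f =>
      rw [cover_inr_mem_coverMap_iff] at hbo
      rw [centredSquareGraph_adj_inl_inr_iff] at hab
      exact cover_openConnIn_coverFst hao (win x haW).1 (win x haW).2 (coverVertex_mem_coverEdge hab hbo)
  | inr f =>
    cases b with
    | inl y =>
      rw [cover_inr_mem_coverMap_iff] at hao
      have hab' := hab.symm
      rw [centredSquareGraph_adj_inl_inr_iff] at hab'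
      exact (openConnIn_comm _ _ _) ▸
        (cover_openConnIn_coverFst hbo (win y hbW).1 (win y hbW).2 (coverVertex_mem_coverEdge hab' hao))
    | inr g => exact absurd hab (not_centredSquareGraph_adj_inr_inr f g)

/-- **Direction A (site ⇒ bond, enlarged window).** If the covering configuration of `η` has a crude site
crossing of `(Ω; A, B)` at mesh `δ` on `G_s` (frame `coverZ`), then `η` has an open bond path of `ℤ²` (frame
`squareLatticeEmbedding.z`) with all vertices in the `δ`-thickening of `Ω`, from within `3δ` of `A` to within
`3δ` of `B`. [cite: Beffara2008Universal, §5.1] -/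
theorem cover_preimage_siteCross_subset (Ω A B : Set ℂ) {δ : ℝ} (hδ : 0 < δ) :
    coverMap ⁻¹' siteEmbDomainCrossing centredSquareGraph coverZ Ω δ A B ⊆
      openCrossing {y : Site 2 | (δ : ℂ) * squareLatticeEmbedding.z y ∈ Metric.thickening δ Ω}
        {u | Metric.infDist ((δ : ℂ) * squareLatticeEmbedding.z u) A ≤ 3 * δ}
        {v | Metric.infDist ((δ : ℂ) * squareLatticeEmbedding.z v) B ≤ 3 * δ} := by
  intro η hη
  obtain ⟨u, v, hu, hv, huo, hvo, huW, hvW, hreach⟩ := hη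
  set rep : MixedSite → Site 2 := Sum.elim coverFst coverVertex with hrep
  -- slack transfer at an endpoint
  have slack : ∀ {a : MixedSite} {C : Set ℂ}, a ∈ coverMap η →
      Metric.infDist ((δ : ℂ) * coverZ a) C ≤ 2 * δ →
      Metric.infDist ((δ : ℂ) * squareLatticeEmbedding.z (rep a)) C ≤ 3 * δ := by
    intro a C hao ha
    cases a with
    | inl x => exact cover_infDist_le_three hδ ha (cover_dist_coverFst x)
    | inr f =>
      rw [cover_inr_mem_coverMap_iff] at hao
      rw [hrep, Sum.elim_inr, ← cover_z_inr_eq hao]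
      linarith
  refine ⟨rep u, slack huo hu, rep v, slack hvo hv, ?_⟩
  -- transfer of the path, by induction along the site walk
  rw [SimpleGraph.reachable_iff_reflTransGen] at hreach
  suffices key : ∀ b : {y // y ∈ {y : MixedSite | (δ : ℂ) * coverZ y ∈ Ω}},
      Relation.ReflTransGen ((siteOpenGraph centredSquareGraph (coverMap η)).induce
        {y : MixedSite | (δ : ℂ) * coverZ y ∈ Ω}).Adj ⟨u, huW⟩ b →
      η ∈ openConnIn {y : Site 2 | (δ : ℂ) * squareLatticeEmbedding.z y ∈ Metric.thickening δ Ω}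
        (rep u) (rep b.1) from key ⟨v, hvW⟩ hreach
  intro b hb
  induction hb with
  | refl =>
    have h := cover_rep_mem_window hδ huo huW
    exact ⟨h, h, SimpleGraph.Reachable.refl _⟩
  | @tail c b _ hcb ih =>
    simp only [SimpleGraph.comap_adj, Function.Embedding.coe_subtype, siteOpenGraph_adj] at hcb
    obtain ⟨hadj, hco, hbo⟩ := hcb
    have hcW : (δ : ℂ) * coverZ c.1 ∈ Ω := c.2
    have hbW : (δ : ℂ) * coverZ b.1 ∈ Ω := b.2
    exact PlanarDuality.openConnIn_trans ih (cover_step_site_to_bond hδ hadj hco hbo hcW hbW)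

/-! ### Direction B: a bond crossing of the eroded window is a site crossing of `Ω` -/

/-- **One step of direction B.** An open lattice edge `y — y + eᵢ` whose endpoints are centres of closed
`δ`-balls inside `Ω` gives, in the covering configuration, the open site path
`inr (coverFace y) — inl (coverSite y i) — inr (coverFace (y + eᵢ))` inside the window `Ω`.
[cite: Beffara2008Universal, §5.1] -/
theorem cover_step_bond_to_site {δ : ℝ} (hδ : 0 < δ) {Ω : Set ℂ} {η : Set (Sym2 (Site 2))}
    {y : Site 2} {i : Fin 2} (he : s(y, y + Pi.single i 1) ∈ η)
    (hy : Metric.closedBall ((δ : ℂ) * squareLatticeEmbedding.z y) δ ⊆ Ω)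
    (hy' : Metric.closedBall ((δ : ℂ) * squareLatticeEmbedding.z (y + Pi.single i 1)) δ ⊆ Ω) :
    coverMap η ∈ siteConnIn centredSquareGraph {w : MixedSite | (δ : ℂ) * coverZ w ∈ Ω}
      (Sum.inr (coverFace y)) (Sum.inr (coverFace (y + Pi.single i 1))) := by
  have hmo : (Sum.inl (coverSite y i) : MixedSite) ∈ coverMap η := by
    rw [cover_inl_mem_coverMap_iff, coverEdge_coverSite]; exact he
  have hmW : (δ : ℂ) * coverZ (Sum.inl (coverSite y i)) ∈ Ω :=
    cover_mem_of_closedBall_subset hδ hy (cover_dist_coverSite y i)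
  have hfo : ∀ z : Site 2, (Sum.inr (coverFace z) : MixedSite) ∈ coverMap η :=
    fun z => (cover_inr_mem_coverMap_iff η _).2 (cover_not_even_coverFace z)
  have hfW : ∀ z : Site 2, Metric.closedBall ((δ : ℂ) * squareLatticeEmbedding.z z) δ ⊆ Ω →
      (δ : ℂ) * coverZ (Sum.inr (coverFace z)) ∈ Ω := by
    intro z hz
    rw [cover_coverZ_inr_coverFace]
    exact hz (Metric.mem_closedBall_self hδ.le)
  have h1 : coverMap η ∈ siteConnIn centredSquareGraph {w : MixedSite | (δ : ℂ) * coverZ w ∈ Ω}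
      (Sum.inr (coverFace y)) (Sum.inl (coverSite y i)) :=
    mem_siteConnIn_of_adj _ (hfo y) hmo (hfW y hy) hmW (cover_adj_coverSite_coverFace y i).symm
  have h2 : coverMap η ∈ siteConnIn centredSquareGraph {w : MixedSite | (δ : ℂ) * coverZ w ∈ Ω}
      (Sum.inl (coverSite y i)) (Sum.inr (coverFace (y + Pi.single i 1))) :=
    mem_siteConnIn_of_adj _ hmo (hfo _) hmW (hfW _ hy') (cover_adj_coverSite_coverFace_add y i)
  exact siteConnIn_trans _ subset_rfl subset_rfl h1 h2

/-- **Direction B (bond ⇒ site, eroded window).** For a lattice configuration `η ⊆ E(ℤ²)`: if `η` has a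
crude bond crossing of `(Ω⁻; A, B)` at mesh `δ`, where `Ω⁻ = {w | closedBall w δ ⊆ Ω}` is the `δ`-erosion of
`Ω` (so every vertex of the path keeps distance `δ` from `Ωᶜ`), then its covering configuration has a crude
site crossing of `(Ω; A, B)` at mesh `δ` on `G_s`: the path `y₀ — y₁ — ⋯` becomes
`inr (coverFace y₀) — inl (site of y₀y₁) — inr (coverFace y₁) — ⋯`, whose centres sit exactly on the
vertices (same slack) and whose type-I sites are the midpoints (within `δ√2/2 ≤ δ`). [cite: Beffara2008Universal, §5.1] -/
theorem cover_bondCross_subset_preimage : ∀ (Ω A B : Set ℂ) {δ : ℝ}, 0 < δ → ∀ {η : Set (Sym2 (Literature.Probability.LatticeModels.Site 2))}, η ⊆ (Literature.Probability.LatticeModels.zdGraph 2).edgeSet → η ∈ Literature.Probability.Percolation.embDomainCrossing Literature.Probability.LatticeModels.squareLatticeEmbedding.z {w | Metric.closedBall w δ ⊆ Ω} δ A B → Summit.CriticalPhenomena.CardyFormulaZ2.Cruxes.CoveringLeg.FiveArmNull.coverMap η ∈ Literature.Probability.Percolation.siteEmbDomainCrossing Literature.Probability.Percolation.centredSquareGraph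 Summit.CriticalPhenomena.CardyFormulaZ2.Cruxes.CoveringLeg.FiveArmNull.coverZ Ω δ A B := by
  intro Ω A B δ hδ η hη h
  rw [mem_embDomainCrossing_iff] at h
  obtain ⟨u, hu, v, hv, huS, hvS, hreach⟩ := h
  refine ⟨Sum.inr (coverFace u), Sum.inr (coverFace v), ?_, ?_, ?_⟩
  · rwa [cover_coverZ_inr_coverFace]
  · rwa [cover_coverZ_inr_coverFace]
  rw [SimpleGraph.reachable_iff_reflTransGen] at hreach
  suffices key : ∀ b : {y // y ∈ {y : Site 2 | (δ : ℂ) * squareLatticeEmbedding.z y ∈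
      {w : ℂ | Metric.closedBall w δ ⊆ Ω}}},
      Relation.ReflTransGen ((openGraph η).induce {y : Site 2 | (δ : ℂ) * squareLatticeEmbedding.z y ∈
        {w : ℂ | Metric.closedBall w δ ⊆ Ω}}).Adj ⟨u, huS⟩ b →
      coverMap η ∈ siteConnIn centredSquareGraph {w : MixedSite | (δ : ℂ) * coverZ w ∈ Ω}
        (Sum.inr (coverFace u)) (Sum.inr (coverFace b.1)) from key ⟨v, hvS⟩ hreach
  intro b hb
  induction hb with
  | refl =>
    refine mem_siteConnIn_self _ ((cover_inr_mem_coverMap_iff η _).2 (cover_not_even_coverFace u)) ?_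
    show (δ : ℂ) * coverZ (Sum.inr (coverFace u)) ∈ Ω
    rw [cover_coverZ_inr_coverFace]
    exact huS (Metric.mem_closedBall_self hδ.le)
  | @tail c b _ hcb ih =>
    simp only [SimpleGraph.comap_adj, Function.Embedding.coe_subtype, openGraph_adj] at hcb
    obtain ⟨he, hne⟩ := hcb
    have hadj : (zdGraph 2).Adj c.1 b.1 := by
      have := hη he
      rwa [SimpleGraph.mem_edgeSet] at this
    obtain ⟨i, hi | hi⟩ := (zdGraph_adj_iff _ _).1 hadj
    · have hstep := cover_step_bond_to_site (η := η) (y := c.1) (i := i) hδ (by rw [← hi]; exact he)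
        c.2 (by rw [← hi]; exact b.2)
      rw [← hi] at hstep
      exact siteConnIn_trans _ subset_rfl subset_rfl ih hstep
    · have hstep := cover_step_bond_to_site (η := η) (y := b.1) (i := i) hδ
        (by rw [← hi, Sym2.eq_swap]; exact he) b.2 (by rw [← hi]; exact c.2)
      rw [← hi] at hstep
      rw [siteConnIn_comm] at hstep
      exact siteConnIn_trans _ subset_rfl subset_rfl ih hstep

end Summit.CriticalPhenomena.CardyFormulaZ2.Cruxes.CoveringLeg.FiveArmNull

end
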